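import Summits.QuantumFields.YangMills.Theorems.UnitScaleTiltProp7Growth142T3ChartEL
import HarnessLib

/-!
# Route `UnitScaleTilt`, crux K1 child «MinimiserStabilityRegPr» (stmt-QuantumFields-19200) — Σ_k-CURVES FROM FIBRE CURVES AND GAUGE PARAMETERS (the `(γ, ξ, u)` clause of
# the slice rows): twisting a fibre curve `φ` through `W` by the gauge curve `g_t = e^{itN}` gives a curve `γ_t = φ_t^{g_t⁻¹}` with lift `g_t` back into the fibre and
# bond velocity `ξ = ζ − G_W(iN)`, `G_W(μ)(b) = μ(b₋) − W(b)μ(b₊)W(b)^*`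

Cell `ym3-torus`, width seat `ym-ust-19200-w4` (gen 4; ★★OWNER ACK 53 (3): the NORMAL_W knit, brick N2a of the seat's plan 2026-08-28 12:3xZ).  THEOREMS ONLY (0 `def`,
0 `sorry`).  YM₃ on T³ is a ladder rung (R3), not the Clay problem; nothing here claims the stub, the crux, d = 4 or the mass gap.

WHY.  The slice rows of ✓`Prop7LocMinOfSliceRows.wilsonAction4_le_expChart_of_sliceRows_stat` ∕ ✓`PV3ESigmaUniform` ask, per competitor direction, for a curve `γ` through `W`
with a differentiable GAUGE LIFT `u` into `𝔅_k(V)` (`u 0 = 1`) and bond velocities `ξ`, with `Σ_b‖iD(b) − ξ(b)‖` second order (NORMAL_W).  Print's tangent space of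
Σ_k is (fibre tangents) ⊕ (all infinitesimal gauges) ([Balaban1985RegularSpaces] (1.28)–(1.30)); this file realises the ⊕: a fibre curve with velocity `ζ` and a
Hermitian-traceless site field `N` give the Σ_k-curve with velocity `ζ − G_W(iN)`.  The NORMAL_W supplier then needs only a FIBRE curve with velocity
`iD − H·r − G_W(iN)` (implicit function on the descent map, ✓`Node00.CriticalOnFibreTangent.exists_hasDerivAt_curve_of_mem_ker`) — brick N2b.

WHAT IS PROVED (ns `…Theorems.Prop7SigmaCurveOfGauge`).  §1 `hasDerivAt_coe_expHerm_line` (site exponential line `t ↦ e^{itY}`, velocity `iY`), `hasDerivAt_star_coe_expHerm_line`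
(its adjoint, velocity `−iY`).  §2 ★★ `sigmaCurve_props` — for `φ 0 = W`, bond velocities `ζ`, `N` Hermitian-traceless, with `g t x := expHerm ((t:ℂ)•N x)` and
`γ t b := (g t b.src)⁻¹·φ t b·g t b.tgt`: (i) `γ 0 = W`; (ii) `gaugeAct (g t) (γ t) = φ t` for all `t`; (iii) `g 0 = 1`; (iv) the bond velocity of `γ` at `W` is
`ζ(b) − (iN(b₋) − W(b)·iN(b₊)·W(b)^*)`.

HONEST SCOPE.  Matrix calculus (product rule, `exp`); nothing of print asserted; `--supports stmt-QuantumFields-19200`, count-neutral.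

References: T. Bałaban, CMP 99 (1985) 75–102 [Balaban1985RegularSpaces] ((1.28)–(1.30) pp.80–81); CMP 102 (1985) 277–309 [Balaban1985Variational] ((16)–(17) p.280, (141) p.299).
-/

set_option autoImplicit false
noncomputable section

open scoped BigOperators Matrix.Norms.L2Operator Matrix Topology
open Filter NormedSpace

namespace Summit.QuantumFields.YangMills.Theorems.Prop7SigmaCurveOfGauge

open Literature.MathematicalPhysics.QuantumFieldTheory.Balaban1983to89
open Summit.QuantumFields.YangMills.Theorems.Prop7TPrint (expHerm coe_expHerm)
open Summit.QuantumFields.YangMills.Theorems.Prop7Growth142T3ChartEL (herm_tr_ofReal_smul)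

/-! ## §1 The site exponential line -/

/-- `t ↦ e^{itY}` (as a matrix) has derivative `iY` at `0`, for `Y` Hermitian traceless. [cite: Balaban1985Variational, (16)-(17) p.280] -/
theorem hasDerivAt_coe_expHerm_line {Y : Matrix (Fin 2) (Fin 2) ℂ} (hY : Y.IsHermitian ∧ Matrix.trace Y = 0) :
    HasDerivAt (fun t : ℝ => ((expHerm ((t : ℂ) • Y) : Matrix.specialUnitaryGroup (Fin 2) ℂ) : Matrix (Fin 2) (Fin 2) ℂ)) (Complex.I • Y) 0 := by
  have hfun : (fun t : ℝ => ((expHerm ((t : ℂ) • Y) : Matrix.specialUnitaryGroup (Fin 2) ℂ) : Matrix (Fin 2) (Fin 2) ℂ))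
      = (NormedSpace.exp : Matrix (Fin 2) (Fin 2) ℂ → Matrix (Fin 2) (Fin 2) ℂ) ∘ (fun t : ℝ => (t : ℂ) • (Complex.I • Y)) := by
    funext t
    rw [coe_expHerm (herm_tr_ofReal_smul hY t), Function.comp_apply, smul_comm]
  rw [hfun]
  have hexp : HasFDerivAt (NormedSpace.exp : Matrix (Fin 2) (Fin 2) ℂ → Matrix (Fin 2) (Fin 2) ℂ) ((1 : Matrix (Fin 2) (Fin 2) ℂ →L[ℂ] Matrix (Fin 2) (Fin 2) ℂ).restrictScalars ℝ) 0 :=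
    ((hasStrictFDerivAt_exp_zero (𝕂 := ℂ) (𝔸 := Matrix (Fin 2) (Fin 2) ℂ)).hasFDerivAt).restrictScalars ℝ
  have hlin : HasDerivAt (fun t : ℝ => (t : ℂ) • (Complex.I • Y)) (Complex.I • Y) 0 := by
    simpa using (Complex.ofRealCLM.hasDerivAt (x := (0 : ℝ))).smul_const (Complex.I • Y)
  have h00 : (0 : Matrix (Fin 2) (Fin 2) ℂ) = (fun t : ℝ => (t : ℂ) • (Complex.I • Y)) 0 := by simp
  simpa using hexp.comp_hasDerivAt_of_eq (0 : ℝ) hlin h00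

/-- The adjoint line `t ↦ (e^{itY})^*` has derivative `−iY` at `0`. [cite: Balaban1985Variational, (16)-(17) p.280] -/
theorem hasDerivAt_star_coe_expHerm_line {Y : Matrix (Fin 2) (Fin 2) ℂ} (hY : Y.IsHermitian ∧ Matrix.trace Y = 0) :
    HasDerivAt (fun t : ℝ => star (((expHerm ((t : ℂ) • Y) : Matrix.specialUnitaryGroup (Fin 2) ℂ) : Matrix (Fin 2) (Fin 2) ℂ))) (-(Complex.I • Y)) 0 := by
  have h := (hasDerivAt_coe_expHerm_line hY).star
  have hs : star (Complex.I • Y) = -(Complex.I • Y) := by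
    rw [star_smul, Complex.star_def, Complex.conj_I, Matrix.star_eq_conjTranspose, hY.1.eq, neg_smul]
  rw [hs] at h
  exact h

/-! ## §2 The twisted curve -/

/-- ★★ **Σ_k-CURVES FROM A FIBRE CURVE AND A GAUGE PARAMETER.**  `φ` a curve with `φ 0 = W` and bond velocities `ζ`; `N` a Hermitian-traceless site field; gauge curve
`g t x = e^{itN(x)}`, twisted curve `γ t b = (g t b₋)⁻¹·φ t b·g t b₊`.  Then `γ 0 = W`, `(γ t)^{g t} = φ t`, `g 0 = 1`, and the bond velocity of `γ` at `W` is
`ζ(b) − (iN(b₋) − W(b)·iN(b₊)·W(b)^*)` — a fibre velocity minus an infinitesimal gauge direction, i.e. a general tangent vector of Σ_k.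
[cite: Balaban1985RegularSpaces, (1.28)-(1.30) pp.80-81; Balaban1985Variational, (16)-(17) p.280] -/
theorem sigmaCurve_props {P : Params} {j : ℕ} (W : GaugeField P j (Matrix.specialUnitaryGroup (Fin 2) ℂ)) (φ : ℝ → GaugeField P j (Matrix.specialUnitaryGroup (Fin 2) ℂ)) (hφ0 : φ 0 = W)
    (ζ : PBond P j → Matrix (Fin 2) (Fin 2) ℂ) (hφζ : ∀ b : PBond P j, HasDerivAt (fun t : ℝ => (φ t b : Matrix (Fin 2) (Fin 2) ℂ) * star (W b : Matrix (Fin 2) (Fin 2) ℂ)) (ζ b) 0)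
    (N : Site P j → Matrix (Fin 2) (Fin 2) ℂ) (hN : ∀ x, (N x).IsHermitian ∧ Matrix.trace (N x) = 0) :
    ((fun b : PBond P j => (expHerm (((0 : ℝ) : ℂ) • N b.src))⁻¹ * φ 0 b * expHerm (((0 : ℝ) : ℂ) • N b.tgt)) = W) ∧
    (∀ t : ℝ, GaugeField.gaugeAct (fun x => expHerm ((t : ℂ) • N x)) (fun b : PBond P j => (expHerm ((t : ℂ) • N b.src))⁻¹ * φ t b * expHerm ((t : ℂ) • N b.tgt)) = φ t) ∧
    ((fun x : Site P j => expHerm (((0 : ℝ) : ℂ) • N x)) = fun _ => 1) ∧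
    (∀ b : PBond P j, HasDerivAt
      (fun t : ℝ => (((expHerm ((t : ℂ) • N b.src))⁻¹ * φ t b * expHerm ((t : ℂ) • N b.tgt) : Matrix.specialUnitaryGroup (Fin 2) ℂ) : Matrix (Fin 2) (Fin 2) ℂ) * star (W b : Matrix (Fin 2) (Fin 2) ℂ))
      (ζ b - (Complex.I • N b.src - (W b : Matrix (Fin 2) (Fin 2) ℂ) * (Complex.I • N b.tgt) * star (W b : Matrix (Fin 2) (Fin 2) ℂ))) 0) := by
  have h0 : ∀ x, expHerm (((0 : ℝ) : ℂ) • N x) = 1 := fun x => by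
    rw [Complex.ofReal_zero, zero_smul]; exact Prop7TPrint.expHerm_zero
  refine ⟨?_, ?_, ?_, ?_⟩
  · funext b; rw [h0, h0, hφ0, inv_one, one_mul, mul_one]
  · intro t; funext b
    simp only [GaugeField.gaugeAct]
    group
  · funext x; exact h0 x
  · intro b
    have hW : (W b : Matrix (Fin 2) (Fin 2) ℂ) * star (W b : Matrix (Fin 2) (Fin 2) ℂ) = 1 := Matrix.mem_unitaryGroup_iff.mp (W b).2.1
    have hW' : star (W b : Matrix (Fin 2) (Fin 2) ℂ) * (W b : Matrix (Fin 2) (Fin 2) ℂ) = 1 := Matrix.mem_unitaryGroup_iff'.mp (W b).2.1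
    -- rewrite the coordinate as a triple product `A(t)·B(t)·C(t)`
    have hfun : (fun t : ℝ => (((expHerm ((t : ℂ) • N b.src))⁻¹ * φ t b * expHerm ((t : ℂ) • N b.tgt) : Matrix.specialUnitaryGroup (Fin 2) ℂ) : Matrix (Fin 2) (Fin 2) ℂ) * star (W b : Matrix (Fin 2) (Fin 2) ℂ))
        = fun t : ℝ => (star (((expHerm ((t : ℂ) • N b.src) : Matrix.specialUnitaryGroup (Fin 2) ℂ) : Matrix (Fin 2) (Fin 2) ℂ)) * ((φ t b : Matrix (Fin 2) (Fin 2) ℂ) * star (W b : Matrix (Fin 2) (Fin 2) ℂ)))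
            * ((W b : Matrix (Fin 2) (Fin 2) ℂ) * (((expHerm ((t : ℂ) • N b.tgt) : Matrix.specialUnitaryGroup (Fin 2) ℂ) : Matrix (Fin 2) (Fin 2) ℂ)) * star (W b : Matrix (Fin 2) (Fin 2) ℂ)) := by
      funext t
      rw [Submonoid.coe_mul, Submonoid.coe_mul, ← Matrix.star_eq_inv, Matrix.specialUnitaryGroup.coe_star]
      simp only [mul_assoc]
      rw [← mul_assoc (star (W b : Matrix (Fin 2) (Fin 2) ℂ)) (W b : Matrix (Fin 2) (Fin 2) ℂ), hW', one_mul]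
    rw [hfun]
    have hA := hasDerivAt_star_coe_expHerm_line (hN b.src)
    have hB := hφζ b
    have hC : HasDerivAt (fun t : ℝ => (W b : Matrix (Fin 2) (Fin 2) ℂ) * (((expHerm ((t : ℂ) • N b.tgt) : Matrix.specialUnitaryGroup (Fin 2) ℂ) : Matrix (Fin 2) (Fin 2) ℂ)) * star (W b : Matrix (Fin 2) (Fin 2) ℂ))
        ((W b : Matrix (Fin 2) (Fin 2) ℂ) * (Complex.I • N b.tgt) * star (W b : Matrix (Fin 2) (Fin 2) ℂ)) 0 :=
      ((hasDerivAt_coe_expHerm_line (hN b.tgt)).const_mul (W b : Matrix (Fin 2) (Fin 2) ℂ)).mul_const (star (W b : Matrix (Fin 2) (Fin 2) ℂ))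
    have hABC := (hA.mul hB).mul hC
    -- values at `t = 0`
    have hA0 : star (((expHerm (((0 : ℝ) : ℂ) • N b.src) : Matrix.specialUnitaryGroup (Fin 2) ℂ) : Matrix (Fin 2) (Fin 2) ℂ)) = 1 := by rw [h0]; simp
    have hB0 : (φ 0 b : Matrix (Fin 2) (Fin 2) ℂ) * star (W b : Matrix (Fin 2) (Fin 2) ℂ) = 1 := by rw [hφ0]; exact hW
    have hC0 : (W b : Matrix (Fin 2) (Fin 2) ℂ) * (((expHerm (((0 : ℝ) : ℂ) • N b.tgt) : Matrix.specialUnitaryGroup (Fin 2) ℂ) : Matrix (Fin 2) (Fin 2) ℂ)) * star (W b : Matrix (Fin 2) (Fin 2) ℂ) = 1 := by rw [h0]; simp [hW]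
    refine hABC.congr_deriv ?_
    simp only [Pi.mul_apply, hA0, hB0, hC0, one_mul, mul_one]
    noncomm_ring

end Summit.QuantumFields.YangMills.Theorems.Prop7SigmaCurveOfGauge

end
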